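import Summits.QuantumFields.YangMills.Theorems.UnitScaleTiltHalvingHSupURho4OfSockets
import Summits.QuantumFields.YangMills.Theorems.UnitScaleTiltHalvingHSockets2OfRawSockets
import HarnessLib

/-!
# Route `UnitScaleTilt`, crux K1 child «MinimiserStabilityRegPr» (stmt-QuantumFields-19200), registered stub `stub_halvingStep` (v10 `BirthV10`) —
# **LEAD-H g6 (K-final v2.1): «H = hSockets₁′ ∧ hRaw₂»** — ★★★ `hSupUρ4_of_rawSockets (M′) (hM′) (hSockets₁′) (hRaw₂) : <hSupUρ4 VERBATIM>` :=
# ✓`hSupUρ4_of_sockets M′ hM′ hSockets₁′ (hSockets₂'_of_rawSockets M′ hRaw₂)` (★w3-20520 g7's «hT4TL-REDUCE» ✓`HalvingHSockets2OfRawSockets`).  Displayed after this file,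
# step side: per `L` the socket constants with signs and `hP5baseL ∧ hP5L ∧ H59rawL ∧ SB9L ∧ SLetτL ∧ H59TL` — [7] Prop. 5 (1.106)–(1.109) base∕step, the (1.59) edge at every
# level `m ≤ K − n`, the b9 in-edge `SockB9P3` at `K − n − 1`, the [4] Thm 3.1 letters, (1.59) at the top knit gauge — i.e. [7] Thm 4's datum `hT4TL` of v5 is RE-DISPLAYED AS
# ITS PRINT INPUTS (✓`HalvingHT4TLOfRawSockets.hT4TL_of_rawSockets` ∘ ✓p667955 §2 `hT4T_of_rawSockets`, the raw (1.42) leg closed by ✓p666908); base side unchanged (`SLetτL ∧ H59TL`).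
# H door of record: ✓`HalvingStubOfHP1RoomRho4.stub_halvingStep_of_hP1roomρ4` ∘ ✓`HalvingP1FlatPillarRoomOfSuppliersRho4.hP1roomρ4_of_suppliers` ∘ THIS — BOARD v5.1.
# NEXT (v6, in flight): ★w3-19200 g9's «(K-sock)» derives `hP5baseL ∧ hP5L` (and `H59rawL`∕`H59TL` through lit `SockB9P3` at all levels, LEAD-H LOCATE #41) from the [4]
# leaf sockets `SLetτAllL ∧ SB9AllL`, after which nothing of [Balaban1985RegularSpaces] is displayed.

Cell `ym3-torus` (HUMAN RULING D-0037, YM ladder rung R3 — YM₃ on T³ is a RUNG, NOT the Clay problem), width seat `ym-ust-19200-w5` gen 6 (LEAD-H g6).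
`--supports stmt-QuantumFields-19200 --as helper`; count-neutral; def-free, 0 sorry, standard axioms; by-name composition only; nothing here claims the stub, the crux,
the rung or the gap — the displayed sockets are HYPOTHESES (N05∕N06 deliverables).
References: T. Bałaban, CMP **99** (1985) 75–102 [Balaban1985RegularSpaces] Prop. 3 pp.82–83, Thm 4 p.88, Prop. 5 (1.106)–(1.109) p.94; CMP **99** (1985) 389–434
[Balaban1985BackgroundPropagators] Thm 3.1 p.397, Thm 3.3 p.399; CMP **102** (1985) 277–309 [Balaban1985Variational] (150)–(156) pp.301–302.
-/

set_option autoImplicit false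

noncomputable section

open scoped BigOperators Matrix.Norms.L2Operator
open NormedSpace
open Complex (I)

namespace Summit.QuantumFields.YangMills.Theorems.HalvingHSupURho4OfRawSockets

open Literature.MathematicalPhysics.QuantumFieldTheory.Balaban1983to89
open Literature.MathematicalPhysics.QuantumFieldTheory.Balaban1983to89.T3ContinuumYM3Torus
open Literature.MathematicalPhysics.QuantumFieldTheory.Balaban1983to89.T3PrintedRegularMinimiser (RegPr regFibrePr)
open MatrixLog (mlog)
open B5Eq118OneStroke (iterBlockOf)
open B7Prop1Explicit (e expUnit)
open B7Prop1Explicit renaming Site → LSite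
open B7Prop2Explicit (unitaryUnits C0 c2' avgIter)
open B7Prop2SpecialUnitary (specialUnitaryUnits mem_specialUnitaryUnits specialUnitaryUnits_le_unitaryUnits)
open B7Prop3Flat (c3)
open B7Prop10General (C6 C4G)
open B7Prop9Flat (C5')
open B7Prop1Local (InBox loK bondHiK)
open B7Eq78Linearization (conjR zdBlocking QprimeIter)
open B7Eq92Concrete (mgauge)
open B8Ineq130 (tlo thi)
open B8Ineq132 (covDerivFwd InAk)
open B8Eq119TwistedAxial (Restr129 InAx bgT)
open B8Eq131Cubes (cube gs tLo tHi)
open B8Eq131CubesAdmissible (cubeFam)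
open B8CubeMemberZd (cubeLamS cubeLamB)
open B8Eq184Proof (gaugeExp cfgExp)
open B8Eq182Proof (gAd)
open B8Eq188Proof (frakF3)
open B8Eq140Level (SideTouches)
open B8Eq146AExpansion (iEta)
open B8Eq138LandauZd (IsLandau138W covDivB covLap QT logCfg)
open B7Prop4GeneralLevels (logCovIter linCovIter)
open B8Eq155JBound (Jcur wsup)
open B8ScaledSupNorm (bondNorm msup)
open B8Ineq125Concrete (C2p)
open B8Eq1117Concrete (XSpace)
open B8LeafModelZd3 (SockB9P3)
open B8Prop5ContractionKLevel (Bd2 Mc Kc)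
open B8LambdaSpaceKLevel (wt)
open B8Eq178Averages (Qnl)
open B8SpecialUnitaryTrace (trCLM trCLM_apply)
open B10Eq27TorusAxialLog (transl rel pull pull_apply unitsField toUField suIncl gaugeActT axialT unitsField_mem_unitaryUnits)
open B15Eq112TorusCover (lift cover)
open Node00 (coverAt)
open LatticeFieldCalculus (siteAvgIter)
open Summit.QuantumFields.YangMills.Theorems.Prop8ChartDoubleBar (dbarIterU vframeU)
open HalvingHSupURho4OfSockets (hSupUρ4_of_sockets)
open HalvingHSockets2OfRawSockets (hSockets₂'_of_rawSockets)
open Literature.MathematicalPhysics.QuantumFieldTheory.Balaban1983to89.T3PrintedRegularMinimiser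
open B6SectAOperatorsV1 (SiteIdx)
open B7Prop1Explicit (e)
open B7Prop2Explicit (unitaryUnits)
open B7Eq78Linearization (conjR)
open B8Ineq132 (covDerivFwd)
open B8Eq131Cubes (cube gs)
open B8Eq138LandauZd (covDivB covLap QT IsLandau138W logCfg)
open B8CubeMemberZd (cubeLamS)
open B10Eq27TorusAxialLog (transl rel pull unitsField toUField suIncl gaugeActT axialT)
open B15Eq112TorusCover (lift)
open LatticeFieldCalculus (laplace diverg siteAvgIter)
open FlatCubeOpsText (IsLevWeight)
open FlatCubeSequenceAligned (cubeSeqMT3 cubeSetM)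
open HalvingP1FlatPillar (DP1Clause)
open Classical in

/-- ★★★ **(K-final v2.1): «H = hSupUρ4» from the base sockets and the step RAW sockets (Prop. 5 base∕step + (1.59) at every level in place of Thm 4's datum).**
See the module docstring. [cite: Balaban1985RegularSpaces, Prop. 3 (1.36)-(1.42) pp.82-83, Thm 4 p.88, Prop. 5 (1.106)-(1.109) p.94; Balaban1985BackgroundPropagators, Thm 3.1 p.397, Thm 3.3 p.399; Balaban1985Variational, (150)-(156) pp.301-302] -/
theorem hSupUρ4_of_rawSockets (M' : ℕ) (hM' : 1 ≤ M')
    (hSockets₁ : ∀ L : ℕ, Odd L → 1 < L → ∃ (B₀ B₀'H B₂' BG BR cB9 : ℝ), 0 < B₀ ∧ 0 < B₀'H ∧ 0 ≤ B₂' ∧ 0 ≤ BG ∧ 0 ≤ BR ∧ 0 < cB9 ∧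
        -- `SLetτL`: the [4] letters at `(K − n, U₀ := 1)` on every cube family of the member (geometry only)
        (∀ (F : T3Family) (n K : ℕ), n < K → ∀ (a : LSite (F.P K).d) (ρ' : ℕ),
          ∃ (g Δ : (LSite (F.P K).d → (Matrix (Fin 2) (Fin 2) ℂ)) →ₗ[ℂ] (LSite (F.P K).d → (Matrix (Fin 2) (Fin 2) ℂ))) (q : (LSite (F.P K).d → (Matrix (Fin 2) (Fin 2) ℂ)) →ₗ[ℂ] (ℕ → LSite (F.P K).d → (Matrix (Fin 2) (Fin 2) ℂ)))
          (qs : (ℕ → LSite (F.P K).d → (Matrix (Fin 2) (Fin 2) ℂ)) →ₗ[ℂ] (LSite (F.P K).d → (Matrix (Fin 2) (Fin 2) ℂ))) (Aw c : (ℕ → LSite (F.P K).d → (Matrix (Fin 2) (Fin 2) ℂ)) →ₗ[ℂ] (ℕ → LSite (F.P K).d → (Matrix (Fin 2) (Fin 2) ℂ)))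
          (H' : XSpace (F.P K).d (K - n) (Matrix (Fin 2) (Fin 2) ℂ) →ₗ[ℂ] (LSite (F.P K).d → (Matrix (Fin 2) (Fin 2) ℂ))),
          (∀ x, ∀ y ∈ (cubeFam false (F.P K).L a M' ρ' (K - n)) 0, (Δ (g x) + qs (Aw (q (g x)))) y = x y) ∧ (∀ f, q (g (g (qs (c (q f))))) = q f) ∧
          (∀ (f : LSite (F.P K).d → (Matrix (Fin 2) (Fin 2) ℂ)), ∀ x ∈ (cubeFam false (F.P K).L a M' ρ' (K - n)) 0, Δ f x = covLap (((F.L : ℝ)⁻¹) ^ (K - n)) (1 : LSite (F.P K).d → Fin (F.P K).d → (Matrix (Fin 2) (Fin 2) ℂ)ˣ) (((cubeFam false (F.P K).L a M' ρ' (K - n)) 0).indicator f) x) ∧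
          (∀ (μ : ℕ → LSite (F.P K).d → (Matrix (Fin 2) (Fin 2) ℂ)), ∀ x ∈ (cubeFam false (F.P K).L a M' ρ' (K - n)) 0, qs μ x = QT (F.P K).L (K - n) (cubeLamS (F.P K).L a M' ρ' (K - n) (K - n)) (1 : LSite (F.P K).d → Fin (F.P K).d → (Matrix (Fin 2) (Fin 2) ℂ)ˣ) μ x) ∧
          (∀ (f : LSite (F.P K).d → (Matrix (Fin 2) (Fin 2) ℂ)) (j : ℕ), j ≤ K - n → ∀ y ∈ (cubeLamS (F.P K).L a M' ρ' (K - n) (K - n)) j, q f j y = QprimeIter (zdBlocking (F.P K).d (F.P K).L) (bgT (F.P K).L (1 : LSite (F.P K).d → Fin (F.P K).d → (Matrix (Fin 2) (Fin 2) ℂ)ˣ)) j f y) ∧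
          (∀ (X : XSpace (F.P K).d (K - n) (Matrix (Fin 2) (Fin 2) ℂ)) (x : LSite (F.P K).d), ‖H' X x‖ ≤ B₀'H * ‖X‖) ∧
          (∀ j, j ≤ K - n → ∀ (X : XSpace (F.P K).d (K - n) (Matrix (Fin 2) (Fin 2) ℂ)), ∀ p ∈ {b : LSite (F.P K).d × Fin (F.P K).d | SideTouches ((cubeFam false (F.P K).L a M' ρ' (K - n)) j) b.1 b.2},
          wt (F.P K).L (((F.L : ℝ)⁻¹) ^ (K - n)) j * ‖covDerivFwd (((F.L : ℝ)⁻¹) ^ (K - n)) (1 : LSite (F.P K).d → Fin (F.P K).d → (Matrix (Fin 2) (Fin 2) ℂ)ˣ) p.2 (H' X) p.1‖ ≤ B₀'H * ‖X‖) ∧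
          (∀ X : XSpace (F.P K).d (K - n) (Matrix (Fin 2) (Fin 2) ℂ), Bd2 (F.P K).L (((F.L : ℝ)⁻¹) ^ (K - n)) (K - n) (cubeFam false (F.P K).L a M' ρ' (K - n)) (covLap (((F.L : ℝ)⁻¹) ^ (K - n)) (1 : LSite (F.P K).d → Fin (F.P K).d → (Matrix (Fin 2) (Fin 2) ℂ)ˣ) (H' X)) (B₂' * ‖X‖)) ∧
          (∀ (X : XSpace (F.P K).d (K - n) (Matrix (Fin 2) (Fin 2) ℂ)) (x : LSite (F.P K).d), x ∉ (cubeFam false (F.P K).L a M' ρ' (K - n)) 0 → H' X x = 0) ∧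
          (∀ X Y : XSpace (F.P K).d (K - n) (Matrix (Fin 2) (Fin 2) ℂ), (∀ p, Y p = -star (X p)) → ∀ x, H' Y x = -star (H' X x)) ∧
          (∀ (Y : XSpace (F.P K).d (K - n) (Matrix (Fin 2) (Fin 2) ℂ)) (j : ℕ) (hj : j ≤ K - n) (y : LSite (F.P K).d), y ∈ (cubeLamS (F.P K).L a M' ρ' (K - n) (K - n)) j →
          QprimeIter (zdBlocking (F.P K).d (F.P K).L) (bgT (F.P K).L (1 : LSite (F.P K).d → Fin (F.P K).d → (Matrix (Fin 2) (Fin 2) ℂ)ˣ)) j (H' Y) y = Y (⟨j, Nat.lt_succ_of_le hj⟩, y)) ∧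
          (∀ (f : LSite (F.P K).d → (Matrix (Fin 2) (Fin 2) ℂ)) (r : ℝ), 0 ≤ r → Bd2 (F.P K).L (((F.L : ℝ)⁻¹) ^ (K - n)) (K - n) (cubeFam false (F.P K).L a M' ρ' (K - n)) f r →
          (∀ x, ‖g f x‖ ≤ BG * r) ∧ ∀ j, j ≤ K - n → ∀ p ∈ {b : LSite (F.P K).d × Fin (F.P K).d | SideTouches ((cubeFam false (F.P K).L a M' ρ' (K - n)) j) b.1 b.2},
          wt (F.P K).L (((F.L : ℝ)⁻¹) ^ (K - n)) j * ‖covDerivFwd (((F.L : ℝ)⁻¹) ^ (K - n)) (1 : LSite (F.P K).d → Fin (F.P K).d → (Matrix (Fin 2) (Fin 2) ℂ)ˣ) p.2 (g f) p.1‖ ≤ BG * r) ∧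
          (∀ (f : LSite (F.P K).d → (Matrix (Fin 2) (Fin 2) ℂ)) (x : LSite (F.P K).d), x ∉ (cubeFam false (F.P K).L a M' ρ' (K - n)) 0 → g f x = 0) ∧
          (∀ f : LSite (F.P K).d → (Matrix (Fin 2) (Fin 2) ℂ), (∀ j, j ≤ K - n → ∀ x ∈ (cubeFam false (F.P K).L a M' ρ' (K - n)) j, IsSelfAdjoint (f x)) → ∀ x, IsSelfAdjoint (g f x)) ∧
          (∀ (f : LSite (F.P K).d → (Matrix (Fin 2) (Fin 2) ℂ)) (r : ℝ), 0 ≤ r → Bd2 (F.P K).L (((F.L : ℝ)⁻¹) ^ (K - n)) (K - n) (cubeFam false (F.P K).L a M' ρ' (K - n)) f r → Bd2 (F.P K).L (((F.L : ℝ)⁻¹) ^ (K - n)) (K - n) (cubeFam false (F.P K).L a M' ρ' (K - n)) (f - g (qs (c (q (g f))))) (BR * r)) ∧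
          (∀ f : LSite (F.P K).d → (Matrix (Fin 2) (Fin 2) ℂ), (∀ j, j ≤ K - n → ∀ x ∈ (cubeFam false (F.P K).L a M' ρ' (K - n)) j, IsSelfAdjoint (f x)) → ∀ j, j ≤ K - n → ∀ x ∈ (cubeFam false (F.P K).L a M' ρ' (K - n)) j, IsSelfAdjoint ((f - g (qs (c (q (g f))))) x)) ∧
          (∀ X : XSpace (F.P K).d (K - n) (Matrix (Fin 2) (Fin 2) ℂ), (∀ p, trCLM (Fin 2) (X p) = 0) → ∀ x, trCLM (Fin 2) (H' X x) = 0) ∧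
          (∀ f : LSite (F.P K).d → (Matrix (Fin 2) (Fin 2) ℂ), (∀ j, j ≤ K - n → ∀ x ∈ (cubeFam false (F.P K).L a M' ρ' (K - n)) j, trCLM (Fin 2) (f x) = 0) → ∀ x, trCLM (Fin 2) (g f x) = 0) ∧
          (∀ f : LSite (F.P K).d → (Matrix (Fin 2) (Fin 2) ℂ), (∀ j, j ≤ K - n → ∀ x ∈ (cubeFam false (F.P K).L a M' ρ' (K - n)) j, trCLM (Fin 2) (f x) = 0) → ∀ j, j ≤ K - n → ∀ x ∈ (cubeFam false (F.P K).L a M' ρ' (K - n)) j, trCLM (Fin 2) ((f - g (qs (c (q (g f))))) x) = 0)) ∧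
        -- `H59TL`: [4] Thm 3.3 ∕ Prop. 3 (1.59) at `U′ := pull (U^{gJ})♯ 0`, ∀ (gJ, g′)-closed with J3's three rows as guards, under every member datum (ρ4) and the schedule's letters
        (∀ (F : T3Family), F.L = L → ∀ (n K : ℕ) (hnK : n < K) (ρ S M ρ' : ℕ), ρ' = ρ + M + L + S → 1 ≤ M → 2 ≤ S →
          ∀ (a₅ Cr ε₀ ε₁ : ℝ), 0 < Cr → 4 < Cr → 12 * ((ρ : ℝ) + (M : ℝ)) * a₅ ≤ Cr → 0 < ε₁ → 0 < ε₀ → ε₀ ≤ a₅ → Cr * ε₁ ≤ ε₀ →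
          (10 : ℝ) ^ 29 * (L : ℝ) ^ 12 * (1 + B₀ + B₀⁻¹) ^ 2 * ((1 + B₀'H) * (1 + B₂') * (1 + BG) * (1 + BR)) ^ 5 * (1 + cB9⁻¹) *
            ((((ρ + M + L + S : ℕ) : ℝ) + (M' : ℝ) + 1) ^ 3 * ε₀) ≤ 1 →
          2 * ρ + (M' + 1 + 2 * (M + L + S)) ≤ F.L ^ (F.m + n) →
          ∀ (V : GaugeField (F.P n) 0 (Matrix.specialUnitaryGroup (Fin 2) ℂ)), PlaqSmall ε₁ V → ∀ U ∈ regFibrePr F n K hnK.le ε₀ V,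
          ∀ (x₀ : Site (F.P K) 0) (t : ℤ), 0 ≤ t → t ≤ (M' : ℤ) - 1 →
          ∀ (a : LSite (F.P K).d), a = (fun μ => ((iterBlockOf (K - n) x₀ μ).val : ℤ) - t) →
          ∀ (α₁ α₄ cstar : ℝ), α₁ = 198 * (((ρ' : ℝ) + M' + 1) * ε₀) + 27 * (((ρ' : ℝ) + M' + 1) * ε₀) / ((L : ℝ) * B₀) →
          cstar = 5 * (F.P K).d * (F.P K).L * B₀ * (ε₀ + α₁) →
          α₄ = 8 * (300 * (L : ℝ) * ((3 * (M' + ρ') + 1 : ℕ) : ℝ) * (B₀'H + 15 * (L : ℝ) ^ 2 * BG * BR + 3 * BG * BR * B₂')) * (5 * ((3 : ℕ) : ℝ) * L * B₀) * (ε₀ + α₁) →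
          ∀ (s : ℝ), s = (198 + 12 * (((M' : ℝ) - 1) + 4 * ρ')) * ε₀ →
          ∀ (gJ : GaugeTransf (F.P K) 0 (Matrix.specialUnitaryGroup (Fin 2) ℂ)),
          InAk (F.P K).L (K - n) (((F.L : ℝ)⁻¹) ^ (K - n)) ε₀ (fun _ => (Set.univ : Set (LSite (F.P K).d))) (pull (unitsField (toUField (GaugeField.gaugeAct gJ U))) 0) →
          (∀ m', m' ≤ K - n → ∀ Λ : ℕ → Set (LSite (F.P K).d), InAx (F.P K).L m' Λ (1 : LSite (F.P K).d → Fin (F.P K).d → (Matrix (Fin 2) (Fin 2) ℂ)ˣ) (pull (unitsField (toUField (GaugeField.gaugeAct gJ U))) 0)) →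
          (∀ m', m' ≤ K - n → ∀ (x : LSite (F.P K).d) (ν : Fin (F.P K).d), tlo (F.P K).L (tLo a ρ') m' ≤ x → x + e ν ≤ thi (F.P K).L (tHi a M' ρ') m' →
            ‖((avgIter (F.P K).L (pull (unitsField (toUField (GaugeField.gaugeAct gJ U))) 0) (K - n - m') x ν : (Matrix (Fin 2) (Fin 2) ℂ)ˣ) :
                Matrix (Fin 2) (Fin 2) ℂ) - 1‖ < s) →
          ∀ (g' : GaugeTransf (F.P K) 0 (Matrix (Fin 2) (Fin 2) ℂ)ˣ) (u : LSite (F.P K).d → (Matrix (Fin 2) (Fin 2) ℂ)ˣ) (V' : LSite (F.P K).d → Fin (F.P K).d → (Matrix (Fin 2) (Fin 2) ℂ)ˣ)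
          (A' : LSite (F.P K).d → Fin (F.P K).d → (Matrix (Fin 2) (Fin 2) ℂ)),
          (∀ x, u x ∈ unitaryUnits (Matrix (Fin 2) (Fin 2) ℂ)) → mgauge (1 : LSite (F.P K).d → Fin (F.P K).d → (Matrix (Fin 2) (Fin 2) ℂ)ˣ) u V' = (pull (unitsField (toUField (GaugeField.gaugeAct gJ U))) 0) →
          Restr129 (F.P K).L (K - n) (Function.update (cubeLamS (F.P K).L a M' ρ' (K - n) (K - n)) (K - n) ∅) (1 : LSite (F.P K).d → Fin (F.P K).d → (Matrix (Fin 2) (Fin 2) ℂ)ˣ) u →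
          (IsLandau138W (F.P K).L (K - n) (((F.L : ℝ)⁻¹) ^ (K - n)) ((cubeFam false (F.P K).L a M' ρ' (K - n)) 0) (cubeLamS (F.P K).L a M' ρ' (K - n) (K - n)) (1 : LSite (F.P K).d → Fin (F.P K).d → (Matrix (Fin 2) (Fin 2) ℂ)ˣ) V' ∧
          (∀ c ∈ (cubeLamB (F.P K).L a M' ρ' (K - n) (K - n)) (K - n), ∀ (y : LSite (F.P K).d) (τ : Fin (F.P K).d),
          InBox (loK (F.P K).L (K - n) c.1) (bondHiK (F.P K).L (K - n) c.1 c.2) y → InBox (loK (F.P K).L (K - n) c.1) (bondHiK (F.P K).L (K - n) c.1 c.2) (y + e τ) →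
          V' y τ = gaugeActT g' (unitsField (toUField U)) ⟨cover (F.P K) y, τ⟩)) →
          (∀ y τ, IsSelfAdjoint (A' y τ)) →
          (∀ j, j ≤ K - n → ∀ y τ, SideTouches ((cubeFam false (F.P K).L a M' ρ' (K - n)) j) y τ →
          V' y τ = cfgExp (((F.L : ℝ)⁻¹) ^ (K - n)) A' y τ ∧ ‖A' y τ‖ ≤ (2 * ((F.P K).L * cstar) + 8 * α₄) * (((F.P K).L : ℝ) ^ j * (((F.L : ℝ)⁻¹) ^ (K - n)))⁻¹) →
          (∀ y τ, (∀ j, j ≤ K - n → ¬ SideTouches ((cubeFam false (F.P K).L a M' ρ' (K - n)) j) y τ) → A' y τ = 0) →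
          msup (F.P K).L (K - n) (((F.L : ℝ)⁻¹) ^ (K - n)) (-(1 : ℝ)) (fun j (b : LSite (F.P K).d × Fin (F.P K).d) => SideTouches ((cubeFam false (F.P K).L a M' ρ' (K - n)) j) b.1 b.2) (fun b => A' b.1 b.2)
          ≤ B₀ * (bondNorm (F.P K).L (K - n) (((F.L : ℝ)⁻¹) ^ (K - n)) (-(3 : ℝ)) (cubeFam false (F.P K).L a M' ρ' (K - n)) (fun x μ => Jcur (((F.L : ℝ)⁻¹) ^ (K - n)) (1 : LSite (F.P K).d → Fin (F.P K).d → (Matrix (Fin 2) (Fin 2) ℂ)ˣ) A' μ x)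
          + wsup 1 (fun p : {p : ℕ × (LSite (F.P K).d × Fin (F.P K).d) // p.1 ≤ K - n ∧ p.2 ∈ (cubeLamB (F.P K).L a M' ρ' (K - n) (K - n)) p.1} =>
          linCovIter (F.P K).L (1 : LSite (F.P K).d → Fin (F.P K).d → (Matrix (Fin 2) (Fin 2) ℂ)ˣ) (iEta (((F.L : ℝ)⁻¹) ^ (K - n)) A') p.1.1 p.1.2.1 p.1.2.2)) ∧
          msup (F.P K).L (K - n) (((F.L : ℝ)⁻¹) ^ (K - n)) (-(2 : ℝ)) (fun j (t : Fin (F.P K).d × Fin (F.P K).d × LSite (F.P K).d) => SideTouches ((cubeFam false (F.P K).L a M' ρ' (K - n)) j) t.2.2 t.2.1)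
          (fun t => covDerivFwd (((F.L : ℝ)⁻¹) ^ (K - n)) (1 : LSite (F.P K).d → Fin (F.P K).d → (Matrix (Fin 2) (Fin 2) ℂ)ˣ) t.1 (fun z => A' z t.2.1) t.2.2)
          ≤ B₀ * (bondNorm (F.P K).L (K - n) (((F.L : ℝ)⁻¹) ^ (K - n)) (-(3 : ℝ)) (cubeFam false (F.P K).L a M' ρ' (K - n)) (fun x μ => Jcur (((F.L : ℝ)⁻¹) ^ (K - n)) (1 : LSite (F.P K).d → Fin (F.P K).d → (Matrix (Fin 2) (Fin 2) ℂ)ˣ) A' μ x)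
          + wsup 1 (fun p : {p : ℕ × (LSite (F.P K).d × Fin (F.P K).d) // p.1 ≤ K - n ∧ p.2 ∈ (cubeLamB (F.P K).L a M' ρ' (K - n) (K - n)) p.1} =>
          linCovIter (F.P K).L (1 : LSite (F.P K).d → Fin (F.P K).d → (Matrix (Fin 2) (Fin 2) ℂ)ˣ) (iEta (((F.L : ℝ)⁻¹) ^ (K - n)) A') p.1.1 p.1.2.1 p.1.2.2))))
    (hRaw₂ : ∀ L : ℕ, Odd L → 1 < L → ∃ (B₀ B₀'H B₂' BG BR cB9 B₀β β : ℝ), 0 < B₀ ∧ 0 < B₀'H ∧ 0 ≤ B₂' ∧ 0 ≤ BG ∧ 0 ≤ BR ∧ 0 < cB9 ∧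
        -- `hP5baseL` ∕ `hP5L`: [7] Prop. 5 base∕step at `U′`, ∀ gJ-closed under J3's three rows, under every ρ4 member datum; `H59rawL`: [4] Thm 3.3 at every level, same closure
        (∀ (F : T3Family), F.L = L → ∀ (n K : ℕ) (hnK : n < K) (ρ S M ρ' : ℕ), ρ' = ρ + M + L + S → 1 ≤ M → 2 ≤ S →
          ∀ (a₅ Cr ε₀ ε₁ : ℝ), 0 < Cr → 4 < Cr → 12 * ((ρ : ℝ) + (M : ℝ)) * a₅ ≤ Cr → 0 < ε₁ → 0 < ε₀ → ε₀ ≤ a₅ → Cr * ε₁ ≤ ε₀ →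
          (10 : ℝ) ^ 29 * (L : ℝ) ^ 12 * (1 + B₀ + B₀⁻¹) ^ 2 * ((1 + B₀'H) * (1 + B₂') * (1 + BG) * (1 + BR)) ^ 5 * (1 + cB9⁻¹) *
            ((((ρ + M + L + S : ℕ) : ℝ) + (M' : ℝ) + 1) ^ 3 * ε₀) ≤ 1 →
          2 * ρ + (M' + 1 + 2 * (M + L + S)) ≤ F.L ^ (F.m + n) →
          ∀ (V : GaugeField (F.P n) 0 (Matrix.specialUnitaryGroup (Fin 2) ℂ)), PlaqSmall ε₁ V → ∀ U ∈ regFibrePr F n K hnK.le ε₀ V,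
          ∀ (x₀ : Site (F.P K) 0) (t : ℤ), 0 ≤ t → t ≤ (M' : ℤ) - 1 →
          ∀ (a : LSite (F.P K).d), a = (fun μ => ((iterBlockOf (K - n) x₀ μ).val : ℤ) - t) →
          ∀ (α₁ α₄ cstar : ℝ), α₁ = 198 * (((ρ' : ℝ) + M' + 1) * ε₀) + 27 * (((ρ' : ℝ) + M' + 1) * ε₀) / ((L : ℝ) * B₀) →
          cstar = 5 * (F.P K).d * (F.P K).L * B₀ * (ε₀ + α₁) →
          α₄ = 8 * (300 * (L : ℝ) * ((3 * (M' + ρ') + 1 : ℕ) : ℝ) * (B₀'H + 15 * (L : ℝ) ^ 2 * BG * BR + 3 * BG * BR * B₂')) * (5 * ((3 : ℕ) : ℝ) * L * B₀) * (ε₀ + α₁) →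
          ∀ (s : ℝ), s = (198 + 12 * (((M' : ℝ) - 1) + 4 * ρ')) * ε₀ →
          ∀ gJ : GaugeTransf (F.P K) 0 (Matrix.specialUnitaryGroup (Fin 2) ℂ),
      InAk (F.P K).L (K - n) (((F.L : ℝ)⁻¹) ^ (K - n)) ε₀ (fun _ => (Set.univ : Set (LSite (F.P K).d))) (pull (unitsField (toUField (GaugeField.gaugeAct gJ U))) 0) →
      (∀ m', m' ≤ K - n → ∀ Λ : ℕ → Set (LSite (F.P K).d),
        InAx (F.P K).L m' Λ (1 : LSite (F.P K).d → Fin (F.P K).d → (Matrix (Fin 2) (Fin 2) ℂ)ˣ) (pull (unitsField (toUField (GaugeField.gaugeAct gJ U))) 0)) →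
      (∀ m', m' ≤ K - n → ∀ (x : LSite (F.P K).d) (ν : Fin (F.P K).d), tlo (F.P K).L (tLo a ρ') m' ≤ x → x + e ν ≤ thi (F.P K).L (tHi a M' ρ') m' →
        ‖((avgIter (F.P K).L (pull (unitsField (toUField (GaugeField.gaugeAct gJ U))) 0) (K - n - m') x ν : (Matrix (Fin 2) (Fin 2) ℂ)ˣ) :
            Matrix (Fin 2) (Fin 2) ℂ) - 1‖ < s) →
      ∃ (v : LSite (F.P K).d → (Matrix (Fin 2) (Fin 2) ℂ)ˣ) (lam : LSite (F.P K).d → (Matrix (Fin 2) (Fin 2) ℂ)), (∀ x, v x ∈ specialUnitaryUnits (Fin 2)) ∧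
        (∀ j, j ≤ 1 → ∀ b ∈ {b : LSite (F.P K).d × Fin (F.P K).d | SideTouches ((cubeFam false (F.P K).L a M' ρ' (K - n)) j) b.1 b.2}, (v b.1 : (Matrix (Fin 2) (Fin 2) ℂ)) = ((gaugeExp lam b.1 : (Matrix (Fin 2) (Fin 2) ℂ)ˣ) : (Matrix (Fin 2) (Fin 2) ℂ)) ∧
          (v (b.1 + e b.2) : (Matrix (Fin 2) (Fin 2) ℂ)) = ((gaugeExp lam (b.1 + e b.2) : (Matrix (Fin 2) (Fin 2) ℂ)ˣ) : (Matrix (Fin 2) (Fin 2) ℂ))) ∧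
        (∀ j, j ≤ 1 → ∀ b ∈ {b : LSite (F.P K).d × Fin (F.P K).d | SideTouches ((cubeFam false (F.P K).L a M' ρ' (K - n)) j) b.1 b.2},
          ‖lam b.1‖ ≤ α₄ ∧ (((F.P K).L : ℝ) ^ j * (((F.L : ℝ)⁻¹) ^ (K - n))) * ‖covDerivFwd (((F.L : ℝ)⁻¹) ^ (K - n)) (1 : LSite (F.P K).d → Fin (F.P K).d → (Matrix (Fin 2) (Fin 2) ℂ)ˣ) b.2 lam b.1‖ ≤ α₄) ∧
        IsLandau138W (F.P K).L 1 (((F.L : ℝ)⁻¹) ^ (K - n)) ((cubeFam false (F.P K).L a M' ρ' (K - n)) 0) ((cubeLamS (F.P K).L a M' ρ' (K - n)) 1) (1 : LSite (F.P K).d → Fin (F.P K).d → (Matrix (Fin 2) (Fin 2) ℂ)ˣ) (mgauge (1 : LSite (F.P K).d → Fin (F.P K).d → (Matrix (Fin 2) (Fin 2) ℂ)ˣ) v⁻¹ (pull (unitsField (toUField (GaugeField.gaugeAct gJ U))) 0)) ∧ Restr129 (F.P K).L 1 ((cubeLamS (F.P K).L a M' ρ' (K - n)) 1) (1 : LSite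 (F.P K).d → Fin (F.P K).d → (Matrix (Fin 2) (Fin 2) ℂ)ˣ) ((1 : LSite (F.P K).d → (Matrix (Fin 2) (Fin 2) ℂ)ˣ) * v)) ∧
        (∀ (F : T3Family), F.L = L → ∀ (n K : ℕ) (hnK : n < K) (ρ S M ρ' : ℕ), ρ' = ρ + M + L + S → 1 ≤ M → 2 ≤ S →
          ∀ (a₅ Cr ε₀ ε₁ : ℝ), 0 < Cr → 4 < Cr → 12 * ((ρ : ℝ) + (M : ℝ)) * a₅ ≤ Cr → 0 < ε₁ → 0 < ε₀ → ε₀ ≤ a₅ → Cr * ε₁ ≤ ε₀ →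
          (10 : ℝ) ^ 29 * (L : ℝ) ^ 12 * (1 + B₀ + B₀⁻¹) ^ 2 * ((1 + B₀'H) * (1 + B₂') * (1 + BG) * (1 + BR)) ^ 5 * (1 + cB9⁻¹) *
            ((((ρ + M + L + S : ℕ) : ℝ) + (M' : ℝ) + 1) ^ 3 * ε₀) ≤ 1 →
          2 * ρ + (M' + 1 + 2 * (M + L + S)) ≤ F.L ^ (F.m + n) →
          ∀ (V : GaugeField (F.P n) 0 (Matrix.specialUnitaryGroup (Fin 2) ℂ)), PlaqSmall ε₁ V → ∀ U ∈ regFibrePr F n K hnK.le ε₀ V,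
          ∀ (x₀ : Site (F.P K) 0) (t : ℤ), 0 ≤ t → t ≤ (M' : ℤ) - 1 →
          ∀ (a : LSite (F.P K).d), a = (fun μ => ((iterBlockOf (K - n) x₀ μ).val : ℤ) - t) →
          ∀ (α₁ α₄ cstar : ℝ), α₁ = 198 * (((ρ' : ℝ) + M' + 1) * ε₀) + 27 * (((ρ' : ℝ) + M' + 1) * ε₀) / ((L : ℝ) * B₀) →
          cstar = 5 * (F.P K).d * (F.P K).L * B₀ * (ε₀ + α₁) →
          α₄ = 8 * (300 * (L : ℝ) * ((3 * (M' + ρ') + 1 : ℕ) : ℝ) * (B₀'H + 15 * (L : ℝ) ^ 2 * BG * BR + 3 * BG * BR * B₂')) * (5 * ((3 : ℕ) : ℝ) * L * B₀) * (ε₀ + α₁) →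
          ∀ (s : ℝ), s = (198 + 12 * (((M' : ℝ) - 1) + 4 * ρ')) * ε₀ →
          ∀ gJ : GaugeTransf (F.P K) 0 (Matrix.specialUnitaryGroup (Fin 2) ℂ),
      InAk (F.P K).L (K - n) (((F.L : ℝ)⁻¹) ^ (K - n)) ε₀ (fun _ => (Set.univ : Set (LSite (F.P K).d))) (pull (unitsField (toUField (GaugeField.gaugeAct gJ U))) 0) →
      (∀ m', m' ≤ K - n → ∀ Λ : ℕ → Set (LSite (F.P K).d),
        InAx (F.P K).L m' Λ (1 : LSite (F.P K).d → Fin (F.P K).d → (Matrix (Fin 2) (Fin 2) ℂ)ˣ) (pull (unitsField (toUField (GaugeField.gaugeAct gJ U))) 0)) →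
      (∀ m', m' ≤ K - n → ∀ (x : LSite (F.P K).d) (ν : Fin (F.P K).d), tlo (F.P K).L (tLo a ρ') m' ≤ x → x + e ν ≤ thi (F.P K).L (tHi a M' ρ') m' →
        ‖((avgIter (F.P K).L (pull (unitsField (toUField (GaugeField.gaugeAct gJ U))) 0) (K - n - m') x ν : (Matrix (Fin 2) (Fin 2) ℂ)ˣ) :
            Matrix (Fin 2) (Fin 2) ℂ) - 1‖ < s) →
      ∀ m, 1 ≤ m → m < K - n → ∀ (u₁ : LSite (F.P K).d → (Matrix (Fin 2) (Fin 2) ℂ)ˣ) (U₁ : LSite (F.P K).d → Fin (F.P K).d → (Matrix (Fin 2) (Fin 2) ℂ)ˣ) (A : LSite (F.P K).d → Fin (F.P K).d → (Matrix (Fin 2) (Fin 2) ℂ)),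
      (∀ x, u₁ x ∈ specialUnitaryUnits (Fin 2)) → mgauge (1 : LSite (F.P K).d → Fin (F.P K).d → (Matrix (Fin 2) (Fin 2) ℂ)ˣ) u₁ U₁ = (pull (unitsField (toUField (GaugeField.gaugeAct gJ U))) 0) → Restr129 (F.P K).L m ((cubeLamS (F.P K).L a M' ρ' (K - n)) m) (1 : LSite (F.P K).d → Fin (F.P K).d → (Matrix (Fin 2) (Fin 2) ℂ)ˣ) u₁ → IsLandau138W (F.P K).L m (((F.L : ℝ)⁻¹) ^ (K - n)) ((cubeFam false (F.P K).L a M' ρ' (K - n)) 0) ((cubeLamS (F.P K).L a M' ρ' (K - n)) m) (1 : LSite (F.P K).d → Fin (F.P K).d → (Matrix (Fin 2) (Fin 2) ℂ)ˣ) U₁ →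
      (∀ j, j ≤ m → ∀ b ∈ {b : LSite (F.P K).d × Fin (F.P K).d | SideTouches ((cubeFam false (F.P K).L a M' ρ' (K - n)) j) b.1 b.2},
        U₁ b.1 b.2 = cfgExp (((F.L : ℝ)⁻¹) ^ (K - n)) A b.1 b.2 ∧ IsSelfAdjoint (A b.1 b.2) ∧ ‖A b.1 b.2‖ ≤ cstar * (((F.P K).L : ℝ) ^ j * (((F.L : ℝ)⁻¹) ^ (K - n)))⁻¹) →
      ∃ (v : LSite (F.P K).d → (Matrix (Fin 2) (Fin 2) ℂ)ˣ) (lam : LSite (F.P K).d → (Matrix (Fin 2) (Fin 2) ℂ)), (∀ x, v x ∈ specialUnitaryUnits (Fin 2)) ∧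
        (∀ j, j ≤ m + 1 → ∀ b ∈ {b : LSite (F.P K).d × Fin (F.P K).d | SideTouches ((cubeFam false (F.P K).L a M' ρ' (K - n)) j) b.1 b.2}, (v b.1 : (Matrix (Fin 2) (Fin 2) ℂ)) = ((gaugeExp lam b.1 : (Matrix (Fin 2) (Fin 2) ℂ)ˣ) : (Matrix (Fin 2) (Fin 2) ℂ)) ∧
          (v (b.1 + e b.2) : (Matrix (Fin 2) (Fin 2) ℂ)) = ((gaugeExp lam (b.1 + e b.2) : (Matrix (Fin 2) (Fin 2) ℂ)ˣ) : (Matrix (Fin 2) (Fin 2) ℂ))) ∧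
        (∀ j, j ≤ m + 1 → ∀ b ∈ {b : LSite (F.P K).d × Fin (F.P K).d | SideTouches ((cubeFam false (F.P K).L a M' ρ' (K - n)) j) b.1 b.2},
          ‖lam b.1‖ ≤ α₄ ∧ (((F.P K).L : ℝ) ^ j * (((F.L : ℝ)⁻¹) ^ (K - n))) * ‖covDerivFwd (((F.L : ℝ)⁻¹) ^ (K - n)) (1 : LSite (F.P K).d → Fin (F.P K).d → (Matrix (Fin 2) (Fin 2) ℂ)ˣ) b.2 lam b.1‖ ≤ α₄) ∧
        IsLandau138W (F.P K).L (m + 1) (((F.L : ℝ)⁻¹) ^ (K - n)) ((cubeFam false (F.P K).L a M' ρ' (K - n)) 0) ((cubeLamS (F.P K).L a M' ρ' (K - n)) (m + 1)) (1 : LSite (F.P K).d → Fin (F.P K).d → (Matrix (Fin 2) (Fin 2) ℂ)ˣ) (mgauge (1 : LSite (F.P K).d → Fin (F.P K).d → (Matrix (Fin 2) (Fin 2) ℂ)ˣ) v⁻¹ U₁) ∧ Restr129 (F.P K).L (m + 1) ((cubeLamS (F.P K).L a M' ρ' (K - n)) (m + 1)) (1 : LSite (F.P K).d → Fin (F.P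 K).d → (Matrix (Fin 2) (Fin 2) ℂ)ˣ) (u₁ * v)) ∧
        (∀ (F : T3Family), F.L = L → ∀ (n K : ℕ) (hnK : n < K) (ρ S M ρ' : ℕ), ρ' = ρ + M + L + S → 1 ≤ M → 2 ≤ S →
          ∀ (a₅ Cr ε₀ ε₁ : ℝ), 0 < Cr → 4 < Cr → 12 * ((ρ : ℝ) + (M : ℝ)) * a₅ ≤ Cr → 0 < ε₁ → 0 < ε₀ → ε₀ ≤ a₅ → Cr * ε₁ ≤ ε₀ →
          (10 : ℝ) ^ 29 * (L : ℝ) ^ 12 * (1 + B₀ + B₀⁻¹) ^ 2 * ((1 + B₀'H) * (1 + B₂') * (1 + BG) * (1 + BR)) ^ 5 * (1 + cB9⁻¹) *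
            ((((ρ + M + L + S : ℕ) : ℝ) + (M' : ℝ) + 1) ^ 3 * ε₀) ≤ 1 →
          2 * ρ + (M' + 1 + 2 * (M + L + S)) ≤ F.L ^ (F.m + n) →
          ∀ (V : GaugeField (F.P n) 0 (Matrix.specialUnitaryGroup (Fin 2) ℂ)), PlaqSmall ε₁ V → ∀ U ∈ regFibrePr F n K hnK.le ε₀ V,
          ∀ (x₀ : Site (F.P K) 0) (t : ℤ), 0 ≤ t → t ≤ (M' : ℤ) - 1 →
          ∀ (a : LSite (F.P K).d), a = (fun μ => ((iterBlockOf (K - n) x₀ μ).val : ℤ) - t) →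
          ∀ (α₁ α₄ cstar : ℝ), α₁ = 198 * (((ρ' : ℝ) + M' + 1) * ε₀) + 27 * (((ρ' : ℝ) + M' + 1) * ε₀) / ((L : ℝ) * B₀) →
          cstar = 5 * (F.P K).d * (F.P K).L * B₀ * (ε₀ + α₁) →
          α₄ = 8 * (300 * (L : ℝ) * ((3 * (M' + ρ') + 1 : ℕ) : ℝ) * (B₀'H + 15 * (L : ℝ) ^ 2 * BG * BR + 3 * BG * BR * B₂')) * (5 * ((3 : ℕ) : ℝ) * L * B₀) * (ε₀ + α₁) →
          ∀ (s : ℝ), s = (198 + 12 * (((M' : ℝ) - 1) + 4 * ρ')) * ε₀ →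
          ∀ gJ : GaugeTransf (F.P K) 0 (Matrix.specialUnitaryGroup (Fin 2) ℂ),
      InAk (F.P K).L (K - n) (((F.L : ℝ)⁻¹) ^ (K - n)) ε₀ (fun _ => (Set.univ : Set (LSite (F.P K).d))) (pull (unitsField (toUField (GaugeField.gaugeAct gJ U))) 0) →
      (∀ m', m' ≤ K - n → ∀ Λ : ℕ → Set (LSite (F.P K).d),
        InAx (F.P K).L m' Λ (1 : LSite (F.P K).d → Fin (F.P K).d → (Matrix (Fin 2) (Fin 2) ℂ)ˣ) (pull (unitsField (toUField (GaugeField.gaugeAct gJ U))) 0)) →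
      (∀ m', m' ≤ K - n → ∀ (x : LSite (F.P K).d) (ν : Fin (F.P K).d), tlo (F.P K).L (tLo a ρ') m' ≤ x → x + e ν ≤ thi (F.P K).L (tHi a M' ρ') m' →
        ‖((avgIter (F.P K).L (pull (unitsField (toUField (GaugeField.gaugeAct gJ U))) 0) (K - n - m') x ν : (Matrix (Fin 2) (Fin 2) ℂ)ˣ) :
            Matrix (Fin 2) (Fin 2) ℂ) - 1‖ < s) →
      ∀ m, 1 ≤ m → m ≤ K - n → ∀ (u : LSite (F.P K).d → (Matrix (Fin 2) (Fin 2) ℂ)ˣ) (W : LSite (F.P K).d → Fin (F.P K).d → (Matrix (Fin 2) (Fin 2) ℂ)ˣ) (A' : LSite (F.P K).d → Fin (F.P K).d → (Matrix (Fin 2) (Fin 2) ℂ)),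
      (∀ x, u x ∈ unitaryUnits (Matrix (Fin 2) (Fin 2) ℂ)) → mgauge (1 : LSite (F.P K).d → Fin (F.P K).d → (Matrix (Fin 2) (Fin 2) ℂ)ˣ) u W = (pull (unitsField (toUField (GaugeField.gaugeAct gJ U))) 0) → Restr129 (F.P K).L m ((cubeLamS (F.P K).L a M' ρ' (K - n)) m) (1 : LSite (F.P K).d → Fin (F.P K).d → (Matrix (Fin 2) (Fin 2) ℂ)ˣ) u → IsLandau138W (F.P K).L m (((F.L : ℝ)⁻¹) ^ (K - n)) ((cubeFam false (F.P K).L a M' ρ' (K - n)) 0) ((cubeLamS (F.P K).L a M' ρ' (K - n)) m) (1 : LSite (F.P K).d → Fin (F.P K).d → (Matrix (Fin 2) (Fin 2) ℂ)ˣ) W →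
      (∀ y τ, IsSelfAdjoint (A' y τ)) →
      (∀ j, j ≤ m → ∀ y τ, SideTouches ((cubeFam false (F.P K).L a M' ρ' (K - n)) j) y τ →
        W y τ = cfgExp (((F.L : ℝ)⁻¹) ^ (K - n)) A' y τ ∧ ‖A' y τ‖ ≤ (2 * ((F.P K).L * cstar) + 8 * α₄) * (((F.P K).L : ℝ) ^ j * (((F.L : ℝ)⁻¹) ^ (K - n)))⁻¹) →
      (∀ y τ, (∀ j, j ≤ m → ¬ SideTouches ((cubeFam false (F.P K).L a M' ρ' (K - n)) j) y τ) → A' y τ = 0) →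
      msup (F.P K).L m (((F.L : ℝ)⁻¹) ^ (K - n)) (-(1 : ℝ)) (fun j (b : LSite (F.P K).d × Fin (F.P K).d) => SideTouches ((cubeFam false (F.P K).L a M' ρ' (K - n)) j) b.1 b.2) (fun b => A' b.1 b.2)
          ≤ B₀ * (bondNorm (F.P K).L m (((F.L : ℝ)⁻¹) ^ (K - n)) (-(3 : ℝ)) (cubeFam false (F.P K).L a M' ρ' (K - n)) (fun x μ => Jcur (((F.L : ℝ)⁻¹) ^ (K - n)) (1 : LSite (F.P K).d → Fin (F.P K).d → (Matrix (Fin 2) (Fin 2) ℂ)ˣ) A' μ x)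
            + wsup 1 (fun p : {p : ℕ × (LSite (F.P K).d × Fin (F.P K).d) // p.1 ≤ m ∧ p.2 ∈ (cubeLamB (F.P K).L a M' ρ' (K - n)) m p.1} =>
                linCovIter (F.P K).L (1 : LSite (F.P K).d → Fin (F.P K).d → (Matrix (Fin 2) (Fin 2) ℂ)ˣ) (iEta (((F.L : ℝ)⁻¹) ^ (K - n)) A') p.1.1 p.1.2.1 p.1.2.2)) ∧
        msup (F.P K).L m (((F.L : ℝ)⁻¹) ^ (K - n)) (-(2 : ℝ)) (fun j (t : Fin (F.P K).d × Fin (F.P K).d × LSite (F.P K).d) => SideTouches ((cubeFam false (F.P K).L a M' ρ' (K - n)) j) t.2.2 t.2.1)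
            (fun t => covDerivFwd (((F.L : ℝ)⁻¹) ^ (K - n)) (1 : LSite (F.P K).d → Fin (F.P K).d → (Matrix (Fin 2) (Fin 2) ℂ)ˣ) t.1 (fun z => A' z t.2.1) t.2.2)
          ≤ B₀ * (bondNorm (F.P K).L m (((F.L : ℝ)⁻¹) ^ (K - n)) (-(3 : ℝ)) (cubeFam false (F.P K).L a M' ρ' (K - n)) (fun x μ => Jcur (((F.L : ℝ)⁻¹) ^ (K - n)) (1 : LSite (F.P K).d → Fin (F.P K).d → (Matrix (Fin 2) (Fin 2) ℂ)ˣ) A' μ x)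
            + wsup 1 (fun p : {p : ℕ × (LSite (F.P K).d × Fin (F.P K).d) // p.1 ≤ m ∧ p.2 ∈ (cubeLamB (F.P K).L a M' ρ' (K - n)) m p.1} =>
                linCovIter (F.P K).L (1 : LSite (F.P K).d → Fin (F.P K).d → (Matrix (Fin 2) (Fin 2) ℂ)ˣ) (iEta (((F.L : ℝ)⁻¹) ^ (K - n)) A') p.1.1 p.1.2.1 p.1.2.2))) ∧
        -- `SB9L`: the b9 in-edge of Prop. 3's frame at level `K − n − 1` (lit `SockB9P3` at `M₂(ℂ)`), with its Hölder length `len` per cube family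
        (∀ (F : T3Family) (n K : ℕ), n < K → ∀ (a : LSite (F.P K).d) (ρ' : ℕ), ∃ len : LSite (F.P K).d → ℝ,
          @SockB9P3 (F.P K).d (Matrix (Fin 2) (Fin 2) ℂ) (B10Eq29TubeLine.cstarAlgebraMatrix 2) (F.P K).L B₀ B₀β cB9 β len (((F.L : ℝ)⁻¹) ^ (K - n)) (K - n - 1)
          (cubeFam false (F.P K).L a M' ρ' (K - n)) (cubeLamS (F.P K).L a M' ρ' (K - n)) (cubeLamB (F.P K).L a M' ρ' (K - n))) ∧
        (∀ (F : T3Family) (n K : ℕ), n < K → ∀ (a : LSite (F.P K).d) (ρ' : ℕ),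
          ∃ (g Δ : (LSite (F.P K).d → (Matrix (Fin 2) (Fin 2) ℂ)) →ₗ[ℂ] (LSite (F.P K).d → (Matrix (Fin 2) (Fin 2) ℂ))) (q : (LSite (F.P K).d → (Matrix (Fin 2) (Fin 2) ℂ)) →ₗ[ℂ] (ℕ → LSite (F.P K).d → (Matrix (Fin 2) (Fin 2) ℂ)))
          (qs : (ℕ → LSite (F.P K).d → (Matrix (Fin 2) (Fin 2) ℂ)) →ₗ[ℂ] (LSite (F.P K).d → (Matrix (Fin 2) (Fin 2) ℂ))) (Aw c : (ℕ → LSite (F.P K).d → (Matrix (Fin 2) (Fin 2) ℂ)) →ₗ[ℂ] (ℕ → LSite (F.P K).d → (Matrix (Fin 2) (Fin 2) ℂ)))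
          (H' : XSpace (F.P K).d (K - n) (Matrix (Fin 2) (Fin 2) ℂ) →ₗ[ℂ] (LSite (F.P K).d → (Matrix (Fin 2) (Fin 2) ℂ))),
          (∀ x, ∀ y ∈ (cubeFam false (F.P K).L a M' ρ' (K - n)) 0, (Δ (g x) + qs (Aw (q (g x)))) y = x y) ∧ (∀ f, q (g (g (qs (c (q f))))) = q f) ∧
          (∀ (f : LSite (F.P K).d → (Matrix (Fin 2) (Fin 2) ℂ)), ∀ x ∈ (cubeFam false (F.P K).L a M' ρ' (K - n)) 0, Δ f x = covLap (((F.L : ℝ)⁻¹) ^ (K - n)) (1 : LSite (F.P K).d → Fin (F.P K).d → (Matrix (Fin 2) (Fin 2) ℂ)ˣ) (((cubeFam false (F.P K).L a M' ρ' (K - n)) 0).indicator f) x) ∧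
          (∀ (μ : ℕ → LSite (F.P K).d → (Matrix (Fin 2) (Fin 2) ℂ)), ∀ x ∈ (cubeFam false (F.P K).L a M' ρ' (K - n)) 0, qs μ x = QT (F.P K).L (K - n) (cubeLamS (F.P K).L a M' ρ' (K - n) (K - n)) (1 : LSite (F.P K).d → Fin (F.P K).d → (Matrix (Fin 2) (Fin 2) ℂ)ˣ) μ x) ∧
          (∀ (f : LSite (F.P K).d → (Matrix (Fin 2) (Fin 2) ℂ)) (j : ℕ), j ≤ K - n → ∀ y ∈ (cubeLamS (F.P K).L a M' ρ' (K - n) (K - n)) j, q f j y = QprimeIter (zdBlocking (F.P K).d (F.P K).L) (bgT (F.P K).L (1 : LSite (F.P K).d → Fin (F.P K).d → (Matrix (Fin 2) (Fin 2) ℂ)ˣ)) j f y) ∧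
          (∀ (X : XSpace (F.P K).d (K - n) (Matrix (Fin 2) (Fin 2) ℂ)) (x : LSite (F.P K).d), ‖H' X x‖ ≤ B₀'H * ‖X‖) ∧
          (∀ j, j ≤ K - n → ∀ (X : XSpace (F.P K).d (K - n) (Matrix (Fin 2) (Fin 2) ℂ)), ∀ p ∈ {b : LSite (F.P K).d × Fin (F.P K).d | SideTouches ((cubeFam false (F.P K).L a M' ρ' (K - n)) j) b.1 b.2},
          wt (F.P K).L (((F.L : ℝ)⁻¹) ^ (K - n)) j * ‖covDerivFwd (((F.L : ℝ)⁻¹) ^ (K - n)) (1 : LSite (F.P K).d → Fin (F.P K).d → (Matrix (Fin 2) (Fin 2) ℂ)ˣ) p.2 (H' X) p.1‖ ≤ B₀'H * ‖X‖) ∧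
          (∀ X : XSpace (F.P K).d (K - n) (Matrix (Fin 2) (Fin 2) ℂ), Bd2 (F.P K).L (((F.L : ℝ)⁻¹) ^ (K - n)) (K - n) (cubeFam false (F.P K).L a M' ρ' (K - n)) (covLap (((F.L : ℝ)⁻¹) ^ (K - n)) (1 : LSite (F.P K).d → Fin (F.P K).d → (Matrix (Fin 2) (Fin 2) ℂ)ˣ) (H' X)) (B₂' * ‖X‖)) ∧
          (∀ (X : XSpace (F.P K).d (K - n) (Matrix (Fin 2) (Fin 2) ℂ)) (x : LSite (F.P K).d), x ∉ (cubeFam false (F.P K).L a M' ρ' (K - n)) 0 → H' X x = 0) ∧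
          (∀ X Y : XSpace (F.P K).d (K - n) (Matrix (Fin 2) (Fin 2) ℂ), (∀ p, Y p = -star (X p)) → ∀ x, H' Y x = -star (H' X x)) ∧
          (∀ (Y : XSpace (F.P K).d (K - n) (Matrix (Fin 2) (Fin 2) ℂ)) (j : ℕ) (hj : j ≤ K - n) (y : LSite (F.P K).d), y ∈ (cubeLamS (F.P K).L a M' ρ' (K - n) (K - n)) j →
          QprimeIter (zdBlocking (F.P K).d (F.P K).L) (bgT (F.P K).L (1 : LSite (F.P K).d → Fin (F.P K).d → (Matrix (Fin 2) (Fin 2) ℂ)ˣ)) j (H' Y) y = Y (⟨j, Nat.lt_succ_of_le hj⟩, y)) ∧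
          (∀ (f : LSite (F.P K).d → (Matrix (Fin 2) (Fin 2) ℂ)) (r : ℝ), 0 ≤ r → Bd2 (F.P K).L (((F.L : ℝ)⁻¹) ^ (K - n)) (K - n) (cubeFam false (F.P K).L a M' ρ' (K - n)) f r →
          (∀ x, ‖g f x‖ ≤ BG * r) ∧ ∀ j, j ≤ K - n → ∀ p ∈ {b : LSite (F.P K).d × Fin (F.P K).d | SideTouches ((cubeFam false (F.P K).L a M' ρ' (K - n)) j) b.1 b.2},
          wt (F.P K).L (((F.L : ℝ)⁻¹) ^ (K - n)) j * ‖covDerivFwd (((F.L : ℝ)⁻¹) ^ (K - n)) (1 : LSite (F.P K).d → Fin (F.P K).d → (Matrix (Fin 2) (Fin 2) ℂ)ˣ) p.2 (g f) p.1‖ ≤ BG * r) ∧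
          (∀ (f : LSite (F.P K).d → (Matrix (Fin 2) (Fin 2) ℂ)) (x : LSite (F.P K).d), x ∉ (cubeFam false (F.P K).L a M' ρ' (K - n)) 0 → g f x = 0) ∧
          (∀ f : LSite (F.P K).d → (Matrix (Fin 2) (Fin 2) ℂ), (∀ j, j ≤ K - n → ∀ x ∈ (cubeFam false (F.P K).L a M' ρ' (K - n)) j, IsSelfAdjoint (f x)) → ∀ x, IsSelfAdjoint (g f x)) ∧
          (∀ (f : LSite (F.P K).d → (Matrix (Fin 2) (Fin 2) ℂ)) (r : ℝ), 0 ≤ r → Bd2 (F.P K).L (((F.L : ℝ)⁻¹) ^ (K - n)) (K - n) (cubeFam false (F.P K).L a M' ρ' (K - n)) f r → Bd2 (F.P K).L (((F.L : ℝ)⁻¹) ^ (K - n)) (K - n) (cubeFam false (F.P K).L a M' ρ' (K - n)) (f - g (qs (c (q (g f))))) (BR * r)) ∧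
          (∀ f : LSite (F.P K).d → (Matrix (Fin 2) (Fin 2) ℂ), (∀ j, j ≤ K - n → ∀ x ∈ (cubeFam false (F.P K).L a M' ρ' (K - n)) j, IsSelfAdjoint (f x)) → ∀ j, j ≤ K - n → ∀ x ∈ (cubeFam false (F.P K).L a M' ρ' (K - n)) j, IsSelfAdjoint ((f - g (qs (c (q (g f))))) x)) ∧
          (∀ X : XSpace (F.P K).d (K - n) (Matrix (Fin 2) (Fin 2) ℂ), (∀ p, trCLM (Fin 2) (X p) = 0) → ∀ x, trCLM (Fin 2) (H' X x) = 0) ∧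
          (∀ f : LSite (F.P K).d → (Matrix (Fin 2) (Fin 2) ℂ), (∀ j, j ≤ K - n → ∀ x ∈ (cubeFam false (F.P K).L a M' ρ' (K - n)) j, trCLM (Fin 2) (f x) = 0) → ∀ x, trCLM (Fin 2) (g f x) = 0) ∧
          (∀ f : LSite (F.P K).d → (Matrix (Fin 2) (Fin 2) ℂ), (∀ j, j ≤ K - n → ∀ x ∈ (cubeFam false (F.P K).L a M' ρ' (K - n)) j, trCLM (Fin 2) (f x) = 0) → ∀ j, j ≤ K - n → ∀ x ∈ (cubeFam false (F.P K).L a M' ρ' (K - n)) j, trCLM (Fin 2) ((f - g (qs (c (q (g f))))) x) = 0)) ∧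
        -- `SLetτL` ([4] letters, geometry only) ∕ `H59TL` ([4] Thm 3.3, ∀ (gJ, g′)-closed UNDER J3's three rows incl. the tower row (d), under every ρ4 member datum); `H42L` is GONE (design (D2))
        (∀ (F : T3Family), F.L = L → ∀ (n K : ℕ) (hnK : n < K) (ρ S M ρ' : ℕ), ρ' = ρ + M + L + S → 1 ≤ M → 2 ≤ S →
          ∀ (a₅ Cr ε₀ ε₁ : ℝ), 0 < Cr → 4 < Cr → 12 * ((ρ : ℝ) + (M : ℝ)) * a₅ ≤ Cr → 0 < ε₁ → 0 < ε₀ → ε₀ ≤ a₅ → Cr * ε₁ ≤ ε₀ →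
          (10 : ℝ) ^ 29 * (L : ℝ) ^ 12 * (1 + B₀ + B₀⁻¹) ^ 2 * ((1 + B₀'H) * (1 + B₂') * (1 + BG) * (1 + BR)) ^ 5 * (1 + cB9⁻¹) *
            ((((ρ + M + L + S : ℕ) : ℝ) + (M' : ℝ) + 1) ^ 3 * ε₀) ≤ 1 →
          2 * ρ + (M' + 1 + 2 * (M + L + S)) ≤ F.L ^ (F.m + n) →
          ∀ (V : GaugeField (F.P n) 0 (Matrix.specialUnitaryGroup (Fin 2) ℂ)), PlaqSmall ε₁ V → ∀ U ∈ regFibrePr F n K hnK.le ε₀ V,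
          ∀ (x₀ : Site (F.P K) 0) (t : ℤ), 0 ≤ t → t ≤ (M' : ℤ) - 1 →
          ∀ (a : LSite (F.P K).d), a = (fun μ => ((iterBlockOf (K - n) x₀ μ).val : ℤ) - t) →
          ∀ (α₁ α₄ cstar : ℝ), α₁ = 198 * (((ρ' : ℝ) + M' + 1) * ε₀) + 27 * (((ρ' : ℝ) + M' + 1) * ε₀) / ((L : ℝ) * B₀) →
          cstar = 5 * (F.P K).d * (F.P K).L * B₀ * (ε₀ + α₁) →
          α₄ = 8 * (300 * (L : ℝ) * ((3 * (M' + ρ') + 1 : ℕ) : ℝ) * (B₀'H + 15 * (L : ℝ) ^ 2 * BG * BR + 3 * BG * BR * B₂')) * (5 * ((3 : ℕ) : ℝ) * L * B₀) * (ε₀ + α₁) →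
          ∀ (s : ℝ), s = (198 + 12 * (((M' : ℝ) - 1) + 4 * ρ')) * ε₀ →
          ∀ (gJ : GaugeTransf (F.P K) 0 (Matrix.specialUnitaryGroup (Fin 2) ℂ)),
          InAk (F.P K).L (K - n) (((F.L : ℝ)⁻¹) ^ (K - n)) ε₀ (fun _ => (Set.univ : Set (LSite (F.P K).d))) (pull (unitsField (toUField (GaugeField.gaugeAct gJ U))) 0) →
          (∀ m', m' ≤ K - n → ∀ Λ : ℕ → Set (LSite (F.P K).d), InAx (F.P K).L m' Λ (1 : LSite (F.P K).d → Fin (F.P K).d → (Matrix (Fin 2) (Fin 2) ℂ)ˣ) (pull (unitsField (toUField (GaugeField.gaugeAct gJ U))) 0)) →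
          (∀ m', m' ≤ K - n → ∀ (x : LSite (F.P K).d) (ν : Fin (F.P K).d), tlo (F.P K).L (tLo a ρ') m' ≤ x → x + e ν ≤ thi (F.P K).L (tHi a M' ρ') m' →
          ‖((avgIter (F.P K).L (pull (unitsField (toUField (GaugeField.gaugeAct gJ U))) 0) (K - n - m') x ν : (Matrix (Fin 2) (Fin 2) ℂ)ˣ) : Matrix (Fin 2) (Fin 2) ℂ) - 1‖ < s) →
          ∀ (g' : GaugeTransf (F.P K) 0 (Matrix (Fin 2) (Fin 2) ℂ)ˣ) (u : LSite (F.P K).d → (Matrix (Fin 2) (Fin 2) ℂ)ˣ) (V' : LSite (F.P K).d → Fin (F.P K).d → (Matrix (Fin 2) (Fin 2) ℂ)ˣ)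
          (A' : LSite (F.P K).d → Fin (F.P K).d → (Matrix (Fin 2) (Fin 2) ℂ)),
          (∀ x, u x ∈ unitaryUnits (Matrix (Fin 2) (Fin 2) ℂ)) → mgauge (1 : LSite (F.P K).d → Fin (F.P K).d → (Matrix (Fin 2) (Fin 2) ℂ)ˣ) u V' = (pull (unitsField (toUField (GaugeField.gaugeAct gJ U))) 0) →
          Restr129 (F.P K).L (K - n) (Function.update (cubeLamS (F.P K).L a M' ρ' (K - n) (K - n)) (K - n) ∅) (1 : LSite (F.P K).d → Fin (F.P K).d → (Matrix (Fin 2) (Fin 2) ℂ)ˣ) u →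
          (IsLandau138W (F.P K).L (K - n) (((F.L : ℝ)⁻¹) ^ (K - n)) ((cubeFam false (F.P K).L a M' ρ' (K - n)) 0) (cubeLamS (F.P K).L a M' ρ' (K - n) (K - n)) (1 : LSite (F.P K).d → Fin (F.P K).d → (Matrix (Fin 2) (Fin 2) ℂ)ˣ) V' ∧
          (∀ c ∈ (cubeLamB (F.P K).L a M' ρ' (K - n) (K - n)) (K - n), ∀ (y : LSite (F.P K).d) (τ : Fin (F.P K).d),
          InBox (loK (F.P K).L (K - n) c.1) (bondHiK (F.P K).L (K - n) c.1 c.2) y → InBox (loK (F.P K).L (K - n) c.1) (bondHiK (F.P K).L (K - n) c.1 c.2) (y + e τ) →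
          V' y τ = gaugeActT g' (unitsField (toUField U)) ⟨cover (F.P K) y, τ⟩)) →
          (∀ y τ, IsSelfAdjoint (A' y τ)) →
          (∀ j, j ≤ K - n → ∀ y τ, SideTouches ((cubeFam false (F.P K).L a M' ρ' (K - n)) j) y τ →
          V' y τ = cfgExp (((F.L : ℝ)⁻¹) ^ (K - n)) A' y τ ∧ ‖A' y τ‖ ≤ (2 * ((F.P K).L * cstar) + 8 * α₄) * (((F.P K).L : ℝ) ^ j * (((F.L : ℝ)⁻¹) ^ (K - n)))⁻¹) →
          (∀ y τ, (∀ j, j ≤ K - n → ¬ SideTouches ((cubeFam false (F.P K).L a M' ρ' (K - n)) j) y τ) → A' y τ = 0) →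
          msup (F.P K).L (K - n) (((F.L : ℝ)⁻¹) ^ (K - n)) (-(1 : ℝ)) (fun j (b : LSite (F.P K).d × Fin (F.P K).d) => SideTouches ((cubeFam false (F.P K).L a M' ρ' (K - n)) j) b.1 b.2) (fun b => A' b.1 b.2)
          ≤ B₀ * (bondNorm (F.P K).L (K - n) (((F.L : ℝ)⁻¹) ^ (K - n)) (-(3 : ℝ)) (cubeFam false (F.P K).L a M' ρ' (K - n)) (fun x μ => Jcur (((F.L : ℝ)⁻¹) ^ (K - n)) (1 : LSite (F.P K).d → Fin (F.P K).d → (Matrix (Fin 2) (Fin 2) ℂ)ˣ) A' μ x)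
          + wsup 1 (fun p : {p : ℕ × (LSite (F.P K).d × Fin (F.P K).d) // p.1 ≤ K - n ∧ p.2 ∈ (cubeLamB (F.P K).L a M' ρ' (K - n) (K - n)) p.1} =>
          linCovIter (F.P K).L (1 : LSite (F.P K).d → Fin (F.P K).d → (Matrix (Fin 2) (Fin 2) ℂ)ˣ) (iEta (((F.L : ℝ)⁻¹) ^ (K - n)) A') p.1.1 p.1.2.1 p.1.2.2)) ∧
          msup (F.P K).L (K - n) (((F.L : ℝ)⁻¹) ^ (K - n)) (-(2 : ℝ)) (fun j (t : Fin (F.P K).d × Fin (F.P K).d × LSite (F.P K).d) => SideTouches ((cubeFam false (F.P K).L a M' ρ' (K - n)) j) t.2.2 t.2.1)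
          (fun t => covDerivFwd (((F.L : ℝ)⁻¹) ^ (K - n)) (1 : LSite (F.P K).d → Fin (F.P K).d → (Matrix (Fin 2) (Fin 2) ℂ)ˣ) t.1 (fun z => A' z t.2.1) t.2.2)
          ≤ B₀ * (bondNorm (F.P K).L (K - n) (((F.L : ℝ)⁻¹) ^ (K - n)) (-(3 : ℝ)) (cubeFam false (F.P K).L a M' ρ' (K - n)) (fun x μ => Jcur (((F.L : ℝ)⁻¹) ^ (K - n)) (1 : LSite (F.P K).d → Fin (F.P K).d → (Matrix (Fin 2) (Fin 2) ℂ)ˣ) A' μ x)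
          + wsup 1 (fun p : {p : ℕ × (LSite (F.P K).d × Fin (F.P K).d) // p.1 ≤ K - n ∧ p.2 ∈ (cubeLamB (F.P K).L a M' ρ' (K - n) (K - n)) p.1} =>
          linCovIter (F.P K).L (1 : LSite (F.P K).d → Fin (F.P K).d → (Matrix (Fin 2) (Fin 2) ℂ)ˣ) (iEta (((F.L : ℝ)⁻¹) ^ (K - n)) A') p.1.1 p.1.2.1 p.1.2.2)))) :
    ∀ L : ℕ, Odd L → 1 < L → ∃ (Mₚ Rₚ : ℕ), ∀ (R M aₑ S : ℕ) (hM : 1 ≤ M), M = L ^ aₑ → Mₚ ≤ M → Rₚ ≤ R → R * M ≤ S →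
      ∃ B₁ : ℝ, 0 ≤ B₁ ∧ ∃ M' : ℕ, 1 ≤ M' ∧ ∃ Cρ : ℝ, 0 < Cρ ∧ ∃ qρ : ℕ,
      ∀ (ρ : ℕ) (a Cr : ℝ), 0 < Cr → 4 < Cr → 12 * ((ρ : ℝ) + (M : ℝ)) * a ≤ Cr →
        16 * 3800 * ((5 * L : ℕ) : ℝ) ^ 2 * (L : ℝ) * ((B₁ * ((ρ : ℝ) + 1) ^ qρ + 1) * a) ≤ 1 → Cρ * ((ρ : ℝ) + 1) ^ qρ * a ≤ 1 →
        ∀ F : T3Family, F.L = L → ∀ (n K : ℕ) (hnK : n < K), 2 * ρ + (M' + 1 + 2 * (M + L + S)) ≤ F.L ^ (F.m + n) →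
          ∀ (ε₀ ε₁ : ℝ), 0 < ε₁ → 0 < ε₀ → ε₀ ≤ a → Cr * ε₁ ≤ ε₀ →
          ∀ V : GaugeField (F.P n) 0 (Matrix.specialUnitaryGroup (Fin 2) ℂ), PlaqSmall ε₁ V →
            ∀ U ∈ regFibrePr F n K hnK.le ε₀ V, ∀ x₀ : Site (F.P K) 0,
              ∃ (t : ℤ) (_ : 0 ≤ t) (_ : t ≤ (M' : ℤ) - 1)
                (w : LSite (F.P K).d → Matrix.specialUnitaryGroup (Fin 2) ℂ) (X : LSite (F.P K).d → Fin (F.P K).d → Matrix (Fin 2) (Fin 2) ℂ)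
                (μ : ℕ → LSite (F.P K).d → Matrix (Fin 2) (Fin 2) ℂ)
                (g h' : GaugeTransf (F.P K) 0 (Matrix (Fin 2) (Fin 2) ℂ)ˣ) (κ' : (i : ℕ) → GaugeTransf (F.P K) i (Matrix (Fin 2) (Fin 2) ℂ)ˣ)
                (ν : (i : ℕ) → Site (F.P K) i → (Matrix (Fin 2) (Fin 2) ℂ)ˣ) (gs' : (i : ℕ) → GaugeTransf (F.P K) i (Matrix (Fin 2) (Fin 2) ℂ)ˣ),
                -- [N05 ∕ J3] chart rows and flat Landau window at the corner `a := Bᵏx₀ − t`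
                (∀ z ∈ cube (F.P K).L (fun μ => ((iterBlockOf (K - n) x₀ μ).val : ℤ) - t) M' (ρ + M + L + S) (K - n) 0, ∀ ν : Fin (F.P K).d,
                  transl (0 : Site (F.P K) 0) z ∈ cubeSetM x₀ (K - n) ρ S M 0 → (transl (0 : Site (F.P K) 0) z).shift ν ∈ cubeSetM x₀ (K - n) ρ S M 0 →
                  ‖(((Unitary.toUnits (suIncl (w z)))⁻¹ * unitsField (toUField U) ⟨transl 0 z, ν⟩ * Unitary.toUnits (suIncl (w (z + e ν))) :
                      (Matrix (Fin 2) (Fin 2) ℂ)ˣ) : Matrix (Fin 2) (Fin 2) ℂ) - 1‖ ≤ 1 / 4) ∧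
                (∀ z ∈ cube (F.P K).L (fun μ => ((iterBlockOf (K - n) x₀ μ).val : ℤ) - t) M' (ρ + M + L + S) (K - n) 0, ∀ ν : Fin (F.P K).d,
                  transl (0 : Site (F.P K) 0) z ∈ cubeSetM x₀ (K - n) ρ S M 0 → (transl (0 : Site (F.P K) 0) z).shift ν ∈ cubeSetM x₀ (K - n) ρ S M 0 →
                  I • ((((F.L : ℝ)⁻¹) ^ (K - n)) • X z ν) = mlog (((Unitary.toUnits (suIncl (w z)))⁻¹ * unitsField (toUField U) ⟨transl 0 z, ν⟩ *
                      Unitary.toUnits (suIncl (w (z + e ν))) : (Matrix (Fin 2) (Fin 2) ℂ)ˣ) : Matrix (Fin 2) (Fin 2) ℂ)) ∧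
                (∀ z ∈ cube (F.P K).L (fun μ => ((iterBlockOf (K - n) x₀ μ).val : ℤ) - t) M' (ρ + M + L + S) (K - n) 0,
                  covLap (((F.L : ℝ)⁻¹) ^ (K - n)) (1 : LSite (F.P K).d → Fin (F.P K).d → (Matrix (Fin 2) (Fin 2) ℂ)ˣ)
                      ((cube (F.P K).L (fun μ => ((iterBlockOf (K - n) x₀ μ).val : ℤ) - t) M' (ρ + M + L + S) (K - n) 0).indicator
                        (covDivB (((F.L : ℝ)⁻¹) ^ (K - n)) (1 : LSite (F.P K).d → Fin (F.P K).d → (Matrix (Fin 2) (Fin 2) ℂ)ˣ) X)) z =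
                    QT (F.P K).L (K - n) (cubeLamS (F.P K).L (fun μ => ((iterBlockOf (K - n) x₀ μ).val : ℤ) - t) M' (ρ + M + L + S) (K - n) (K - n))
                      (1 : LSite (F.P K).d → Fin (F.P K).d → (Matrix (Fin 2) (Fin 2) ℂ)ˣ) μ z) ∧
                -- [top step] frames, composite gauge, top identity
                κ' 0 = h' ∧
                (∀ (i : ℕ) (y : Site (F.P K) (i + 1)),
                  κ' (i + 1) y = (vframeU (gaugeActT (κ' i) (dbarIterU i (gaugeActT g (unitsField (toUField U))))) y)⁻¹ * κ' i (emb y) *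
                    vframeU (dbarIterU i (gaugeActT g (unitsField (toUField U)))) y) ∧
                (∀ s, ν 0 s = 1) ∧
                (∀ (i : ℕ) (y : Site (F.P K) (i + 1)), ν (i + 1) y = ν i (emb y) * vframeU (dbarIterU i (gaugeActT g (unitsField (toUField U)))) y) ∧
                gs' 0 = g ∧ (∀ (i : ℕ) (y : Site (F.P K) (i + 1)), gs' (i + 1) y = gs' i (emb y)) ∧
                (∀ s, (Unitary.toUnits (suIncl (w (lift (F.P K) x₀ + rel x₀ s))))⁻¹ =
                  ((gs' (K - n) (iterBlockOf (K - n) x₀))⁻¹ * ν (K - n) (iterBlockOf (K - n) x₀)) * h' s * g s) ∧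
                (∀ yc ∈ cubeLamS (F.P K).L (fun μ => ((iterBlockOf (K - n) x₀ μ).val : ℤ) - t) M' (ρ + M + L + S) (K - n) (K - n) (K - n),
                  κ' (K - n) (coverAt (F.P K) (K - n) yc) =
                    axialT (dbarIterU (K - n) (gaugeActT g (unitsField (toUField U)))) (iterBlockOf (K - n) x₀) (coverAt (F.P K) (K - n) yc)) ∧
                -- [sizes] the two (1.36)♭ rows of `A := X ∘ rep`
                (∀ wt : ℕ → PBond (F.P K) 0 → ℝ, IsLevWeight F n K (cubeSeqMT3 F n K x₀ ρ S M hM) wt →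
                  (∀ b : PBond (F.P K) 0, wt 1 b *
                    ‖(fun b : PBond (F.P K) 0 => if b.src ∈ cubeSetM x₀ (K - n) ρ S M 0 ∧ b.tgt ∈ cubeSetM x₀ (K - n) ρ S M 0 then
                      X (lift (F.P K) x₀ + rel x₀ b.src) b.dir else 0) b‖ ≤ B₁ * ((ρ : ℝ) + 1) ^ qρ * ε₀) ∧
                  (∀ (b : PBond (F.P K) 0) (ν' : Fin (F.P K).d), wt 2 b * (F.L : ℝ) ^ (K - n) *
                    ‖(fun b : PBond (F.P K) 0 => if b.src ∈ cubeSetM x₀ (K - n) ρ S M 0 ∧ b.tgt ∈ cubeSetM x₀ (K - n) ρ S M 0 then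
                        X (lift (F.P K) x₀ + rel x₀ b.src) b.dir else 0) ⟨b.src.shift ν', b.dir⟩ -
                      (fun b : PBond (F.P K) 0 => if b.src ∈ cubeSetM x₀ (K - n) ρ S M 0 ∧ b.tgt ∈ cubeSetM x₀ (K - n) ρ S M 0 then
                        X (lift (F.P K) x₀ + rel x₀ b.src) b.dir else 0) b‖ ≤ B₁ * ((ρ : ℝ) + 1) ^ qρ * ε₀)) :=
  hSupUρ4_of_sockets M' hM' hSockets₁ (hSockets₂'_of_rawSockets M' hRaw₂)

end Summit.QuantumFields.YangMills.Theorems.HalvingHSupURho4OfRawSockets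

end
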